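import Summits.ABC.ABC.Theses.RibetTakahashiSplit
import Literature.NumberTheory.EllipticCurves.SerreFreyValuationProductProofs
import Literature.NumberTheory.EllipticCurves.SzpiroFreyConductorProofs
import Literature.NumberTheory.DiophantineGeometry.MinimalDiscriminantFactorizationProofs
import Literature.NumberTheory.DiophantineGeometry.AbcValuationProduct

/-!
# `AbcValuationProduct` from the two valuation-product cruxes (the Frey translation)

The milestone `AbcValuationProduct` (`∀ ε > 0 ∃ K, ∀ abc triples, ∏_{p ∣ abc} ν_p(abc) ≤ K rad^ε`,
Pasten's product-of-valuations bound with exponent `ε`) follows from the route's cruxes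
`ManyPrimeValuationProduct` (r2: `T(E) ≤ C_ε N^ε` for `E/ℚ` semistable away from `2` with `≥ 4`
odd multiplicative primes) and `FewPrimeValuationProduct` (r4: the same with `≤ 3`), where
`T(E) = ∏_{p ∣ N, p² ∤ N} v_p(Δ_min(E))` (`multiplicativeValuationProduct`). This is the glue
`ValuationProductOfCurves` of the route, proved: `exponentProductBound_of_many_few`. (The route decl
`AbcValuationProduct`, stmt-ABC-1567, was dropped by the gate's LINT AUTOFIX of 2026-08-16, so it is
spelled out via `exponentProduct`, `rfl`-equal to the dropped body, in the three theorems that had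
it in their type, renamed `exponentProductBound_…`; the old names are deprecated aliases below.)

Proof (Frey–Hellegouarch translation, Bombieri–Gubler Ex. 12.5.10). For an abc triple with
`m = abc`:
* if `32 ∣ abc`, Serre's normalisation (`exists_arrangement`: `A ≡ -1 (mod 4)`, `32 ∣ B`,
  `|AB(A+B)| = abc`) gives the semistable Frey curve `freyCurve A B` with `N = rad(abc)` and
  `T = ∏_{p ∣ abc} (2 v_p(abc) - 8·[p = 2])` (`multiplicativeValuationProduct_freyCurve_serre`);
  since `v₂(abc) ≥ 5`, `v₂ ≤ 4 (2 v₂ - 8)` and `∏ v_p(abc) ≤ 4 T`;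
* otherwise `v₂(abc) ≤ 4` and the Frey curve `freyCurve a b = freyIntModel a b ⊗ ℚ` has
  `N ∣ 2⁸ rad(abc)` (`conductorNorm_freyCurve_dvd_holds`), hence is semistable away from `2`; at an
  odd `p ∣ abc` the model (12.17) is minimal with `p ∣ Δ = 16 m²`, so `p ∥ N` and
  `v_p(Δ_min) = v_p(16 m²) ≥ v_p(abc)`; every factor of `T` is `≥ 1` (`N ∣ Δ_min`), so again
  `∏ v_p(abc) ≤ v₂(abc) · ∏_{p odd} v_p(Δ_min) ≤ 4 T`.
In both cases `N ≤ 2⁸ rad(abc)`, and r2 or r4 (according to the number of odd multiplicative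
primes) gives `T ≤ C N^ε ≤ C 2^{8ε} rad^ε`.
-/

-- `Summit.<Summit>.<Problem>` is the mandated summit-side namespace (CONVENTIONS §2); for the
-- single-conjunct summit `ABC` the two coincide, so the duplicate `ABC.ABC` is deliberate.
set_option linter.dupNamespace false

namespace Summit.ABC.ABC.Theorems

open Literature.NumberTheory.DiophantineGeometry Literature.NumberTheory.EllipticCurves
open WeierstrassCurve UniqueFactorizationMonoid IsDedekindDomain Rat.HeightOneSpectrum
open Summit.ABC.ABC.Theses.RibetTakahashiSplit

/-! ### The elementary comparison of the two products -/

/-- Comparison of `∏_{p ∈ S} f p` with `4 ∏_{p ∈ I} g p` when the odd part of `S` lies in `I`,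
`g ≥ 1` on `I`, `f ≤ g` at the odd members of `S`, and at `2` either `f 2 ≤ 4` or `2 ∈ I` with
`f 2 ≤ 4 g 2`. `[folklore]` -/
theorem AbcValuationProduct.prod_le_four_mul_prod {S I : Finset ℕ} {f g : ℕ → ℕ}
    (hSI : S.erase 2 ⊆ I) (hg : ∀ p ∈ I, 1 ≤ g p) (hfg : ∀ p ∈ S.erase 2, f p ≤ g p)
    (h2 : f 2 ≤ 4 ∨ (2 ∈ I ∧ f 2 ≤ 4 * g 2)) :
    ∏ p ∈ S, f p ≤ 4 * ∏ p ∈ I, g p := by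
  classical
  -- split off the prime `2` from `S`
  have hS : ∏ p ∈ S, f p ≤ max (f 2) 1 * ∏ p ∈ S.erase 2, f p := by
    by_cases h2S : 2 ∈ S
    · rw [← Finset.mul_prod_erase S f h2S]; exact Nat.mul_le_mul_right _ (le_max_left _ _)
    · rw [Finset.erase_eq_of_notMem h2S]
      calc ∏ p ∈ S, f p = 1 * ∏ p ∈ S, f p := (one_mul _).symm
        _ ≤ max (f 2) 1 * ∏ p ∈ S, f p := Nat.mul_le_mul_right _ (le_max_right _ _)
  have h1 : ∏ p ∈ S.erase 2, f p ≤ ∏ p ∈ I.erase 2, g p :=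
    calc ∏ p ∈ S.erase 2, f p ≤ ∏ p ∈ S.erase 2, g p :=
          Finset.prod_le_prod (fun _ _ => Nat.zero_le _) hfg
      _ ≤ ∏ p ∈ I.erase 2, g p := Finset.prod_le_prod_of_subset_of_one_le'
            (fun p hp => Finset.mem_erase.2 ⟨(Finset.mem_erase.1 hp).1, hSI hp⟩)
            (fun p hp _ => hg p (Finset.mem_of_mem_erase hp))
  rcases h2 with h2 | ⟨h2I, h2⟩
  · have h3 : ∏ p ∈ I.erase 2, g p ≤ ∏ p ∈ I, g p :=
      Finset.prod_le_prod_of_subset_of_one_le' (Finset.erase_subset _ _) (fun p hp _ => hg p hp)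
    have h4 : max (f 2) 1 ≤ 4 := max_le h2 (by norm_num)
    calc ∏ p ∈ S, f p ≤ max (f 2) 1 * ∏ p ∈ S.erase 2, f p := hS
      _ ≤ 4 * ∏ p ∈ I, g p := Nat.mul_le_mul h4 (h1.trans h3)
  · have h4 : max (f 2) 1 ≤ 4 * g 2 := max_le h2 (by have := hg 2 h2I; omega)
    calc ∏ p ∈ S, f p ≤ max (f 2) 1 * ∏ p ∈ S.erase 2, f p := hS
      _ ≤ (4 * g 2) * ∏ p ∈ I.erase 2, g p := Nat.mul_le_mul h4 h1
      _ = 4 * ∏ p ∈ I, g p := by rw [mul_assoc, Finset.mul_prod_erase I g h2I]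

/-! ### Serre's normalisation when `32 ∣ abc` -/

/-- An abc triple with `32 ∣ abc` admits Serre's arrangement: coprime integers `A ≡ -1 (mod 4)`,
`32 ∣ B` with `|AB(A+B)| = abc` (from `exists_arrangement`, the even member `B` carries the whole
power of `2`). Bombieri–Gubler, Ex. 12.5.10 (a). `[folklore]` -/
theorem AbcValuationProduct.exists_serre_arrangement {a b c : ℕ} (h : IsABCTriple a b c)
    (h32 : 32 ∣ a * b * c) :
    ∃ A B : ℤ, IsCoprime A B ∧ A ≡ -1 [ZMOD 4] ∧ (32 : ℤ) ∣ B ∧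
      (A * B * (A + B)).natAbs = a * b * c := by
  obtain ⟨A, B, hAB, hA, hB, hprod, -⟩ :=
    exists_arrangement h ((show (16 : ℕ) ∣ 32 by norm_num).trans h32)
  refine ⟨A, B, hAB, ?_, ?_, hprod⟩
  · rw [Int.modEq_iff_dvd, show (-1 : ℤ) - A = -(A + 1) by ring, dvd_neg]; exact hA
  · -- `A` and `A + B` are odd, so `32 ∣ |A| |B| |A + B|` forces `32 ∣ B`
    have hAodd : Odd A.natAbs := Int.natAbs_odd.2 (Int.odd_iff.2 (by omega))
    have hABodd : Odd (A + B).natAbs := Int.natAbs_odd.2 (Int.odd_iff.2 (by omega))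
    have h32' : 32 ∣ A.natAbs * B.natAbs * (A + B).natAbs := by
      rw [← Int.natAbs_mul, ← Int.natAbs_mul, hprod]; exact h32
    have hc1 : Nat.Coprime 32 (A + B).natAbs := by
      rw [show (32 : ℕ) = 2 ^ 5 by norm_num]
      exact Nat.Coprime.pow_left 5 (Nat.coprime_two_left.2 hABodd)
    have hc2 : Nat.Coprime 32 A.natAbs := by
      rw [show (32 : ℕ) = 2 ^ 5 by norm_num]
      exact Nat.Coprime.pow_left 5 (Nat.coprime_two_left.2 hAodd)
    have hB32 : 32 ∣ B.natAbs := hc2.dvd_of_dvd_mul_left (hc1.dvd_of_dvd_mul_right h32')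
    exact Int.natCast_dvd.2 hB32

/-! ### The Frey curve of a triple: the case `32 ∣ abc` (semistable, Serre) -/

/-- **Frey translation, `32 ∣ abc`.** For an abc triple with `32 ∣ abc` the Serre-normalised Frey
curve `E = freyCurve A B` is elliptic and semistable with `N_E = rad(abc)` (so its odd
multiplicative primes are the odd primes of `abc`), and `∏_{p ∣ abc} v_p(abc) ≤ 4 T(E)` where
`T(E) = ∏_{p ∥ N} v_p(Δ_min) = ∏_{p ∣ abc} (2 v_p(abc) - 8·[p = 2])` (at `2`: `v₂(abc) ≥ 5`, so
`v₂ ≤ 4 (2 v₂ - 8)`). Bombieri–Gubler Ex. 12.5.10 (a); Pasten,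
*Shimura curves and the abc conjecture*, §16. `[folklore]` -/
theorem AbcValuationProduct.exists_freyCurve_of_dvd {a b c : ℕ} (h : IsABCTriple a b c)
    (h32 : 32 ∣ a * b * c) :
    ∃ W : WeierstrassCurve ℚ, W.IsElliptic ∧
      (∀ p : ℕ, p.Prime → p ≠ 2 → ¬ p ^ 2 ∣ W.conductorNorm ℤ) ∧
      W.conductorNorm ℤ ∣ 2 ^ 8 * rad a b c ∧
      (a * b * c).primeFactors.erase 2 ⊆
        (W.conductorNorm ℤ).primeFactors.filter (fun p => p ≠ 2 ∧ ¬ p ^ 2 ∣ W.conductorNorm ℤ) ∧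
      exponentProduct (a * b * c) ≤ 4 * multiplicativeValuationProduct W := by
  have habc0 : a * b * c ≠ 0 := h.mul_ne_zero
  obtain ⟨A, B, hAB, hA, hB, hprod⟩ := AbcValuationProduct.exists_serre_arrangement h h32
  have h0 : A * B * (A + B) ≠ 0 := by rw [← Int.natAbs_ne_zero, hprod]; exact habc0
  refine ⟨freyCurve A B, isElliptic_freyCurve h0,
    fun p hp _ => freyCurve_serre_semistable hAB h0 hA hB p hp, ?_, ?_, ?_⟩
  · rw [conductorNorm_freyCurve_serre hAB h0 hA hB, hprod, rad_def]; exact dvd_mul_left _ _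
  · rw [oddMultiplicativePrimes_freyCurve_serre hAB h0 hA hB, hprod]
  · rw [multiplicativeValuationProduct_freyCurve_serre hAB h0 hA hB, hprod, exponentProduct_def]
    have h5 : 5 ≤ (a * b * c).factorization 2 :=
      (Nat.prime_two.pow_dvd_iff_le_factorization habc0).1 h32
    have h2S : 2 ∈ (a * b * c).primeFactors :=
      Nat.mem_primeFactors.2 ⟨Nat.prime_two, (show (2 : ℕ) ∣ 32 by norm_num).trans h32, habc0⟩
    refine AbcValuationProduct.prod_le_four_mul_prod (Finset.erase_subset _ _) ?_ ?_
      (Or.inr ⟨h2S, ?_⟩)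
    · intro p hp
      have h1 : 1 ≤ (a * b * c).factorization p :=
        Nat.Prime.factorization_pos_of_dvd (Nat.prime_of_mem_primeFactors hp) habc0
          (Nat.dvd_of_mem_primeFactors hp)
      split_ifs with hp2
      · subst hp2; omega
      · omega
    · intro p hp; rw [if_neg (Finset.ne_of_mem_erase hp)]; omega
    · rw [if_pos rfl]; omega

/-! ### The Frey curve of a triple: the case `32 ∤ abc` -/

/-- **Frey translation, `32 ∤ abc`.** For an abc triple with `32 ∤ abc` (so `v₂(abc) ≤ 4`) the
Frey curve `E : y² = x(x - a)(x + b)` (`freyIntModel a b ⊗ ℚ`) is elliptic with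
`N_E ∣ 2⁸ rad(abc)` (hence semistable away from `2`), every odd `p ∣ abc` is a multiplicative
prime with `v_p(Δ_min) ≥ v_p(abc)` ((12.17) is minimal at `p` with `p ∣ Δ = 16 (abc)²`,
`p ∤ c₄`), and every factor of `T(E)` is `≥ 1` (`N ∣ Δ_min`); hence
`∏_{p ∣ abc} v_p(abc) ≤ 4 T(E)`. Bombieri–Gubler Ex. 12.5.10. `[folklore]` -/
theorem AbcValuationProduct.exists_freyCurve_of_not_dvd {a b c : ℕ} (h : IsABCTriple a b c)
    (h32 : ¬ 32 ∣ a * b * c) :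
    ∃ W : WeierstrassCurve ℚ, W.IsElliptic ∧
      (∀ p : ℕ, p.Prime → p ≠ 2 → ¬ p ^ 2 ∣ W.conductorNorm ℤ) ∧
      W.conductorNorm ℤ ∣ 2 ^ 8 * rad a b c ∧
      (a * b * c).primeFactors.erase 2 ⊆
        (W.conductorNorm ℤ).primeFactors.filter (fun p => p ≠ 2 ∧ ¬ p ^ 2 ∣ W.conductorNorm ℤ) ∧
      exponentProduct (a * b * c) ≤ 4 * multiplicativeValuationProduct W := by
  have habc0 : a * b * c ≠ 0 := h.mul_ne_zero
  obtain ⟨ha, hb, habc, hcop⟩ := h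
  have hab : IsCoprime (a : ℤ) (b : ℤ) := Nat.isCoprime_iff_coprime.mpr hcop
  have hP : (a : ℤ) * b * (a + b) = ((a * b * c : ℕ) : ℤ) := by rw [← habc]; push_cast; ring
  have h0 : (a : ℤ) * b * (a + b) ≠ 0 := by rw [hP]; exact_mod_cast habc0
  set W₀ : WeierstrassCurve ℤ := freyIntModel a b with hW₀
  haveI hE : (W₀.baseChange ℚ).IsElliptic := isElliptic_freyIntModel h0
  -- the conductor divides `2⁸ rad(abc)`
  have hN : (W₀.baseChange ℚ).conductorNorm ℤ ∣ 2 ^ 8 * rad a b c := by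
    have hrad : (radical ((a : ℤ) * b * (a + b))).natAbs = rad a b c := by
      rw [← Int.radical_natAbs_eq_radical, Int.natAbs_natCast, hP, Int.natAbs_natCast, rad_def]
    have := conductorNorm_freyCurve_dvd_holds a b hab h0
    rw [← baseChange_freyIntModel, hrad] at this
    exact this
  -- hence `W₀ ⊗ ℚ` is semistable away from `2`
  have hss : ∀ p : ℕ, p.Prime → p ≠ 2 → ¬ p ^ 2 ∣ (W₀.baseChange ℚ).conductorNorm ℤ := by
    intro p hp hp2 hdvd
    have hcop2 : Nat.Coprime (p ^ 2) (2 ^ 8) :=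
      Nat.Coprime.pow 2 8 ((Nat.coprime_primes hp Nat.prime_two).2 hp2)
    have hrad : p ^ 2 ∣ rad a b c := hcop2.dvd_of_dvd_mul_left (hdvd.trans hN)
    have hsq : Squarefree (rad a b c) := by rw [rad_def]; exact squarefree_radical
    exact Nat.squarefree_iff_prime_squarefree.mp hsq p hp (by simpa [sq] using hrad)
  refine ⟨W₀.baseChange ℚ, hE, hss, hN, ?_⟩
  set N := (W₀.baseChange ℚ).conductorNorm ℤ with hNdef
  set D := (W₀.baseChange ℚ).minimalDiscriminantNorm ℤ with hDdef
  have hD0 : D ≠ 0 := (minimalDiscriminantNorm_pos_holds (W₀.baseChange ℚ)).ne'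
  have hND : N ∣ D := conductorNorm_dvd_minimalDiscriminantNorm (W₀.baseChange ℚ)
    (finite_setOf_ordMinimalDiscriminant_ne_zero_holds _)
  -- local data at an odd prime `p ∣ abc`: `p ∣ N` and `v_p(abc) ≤ v_p(Δ_min)`
  have hodd : ∀ p : ℕ, p.Prime → p ≠ 2 → p ∣ a * b * c →
      p ∈ N.primeFactors ∧ (a * b * c).factorization p ≤ D.factorization p := by
    intro p hp hp2 hpm
    obtain ⟨v, hv⟩ := exists_place ⟨p, hp⟩
    simp only at hv
    have hv2 : natGenerator v ≠ 2 := hv ▸ hp2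
    have hmin := isMinimalAt_freyIntModel_of_natGenerator_ne_two hab v hv2
    have hpm' : (p : ℤ) ∣ (a : ℤ) * b * (a + b) := by rw [hP]; exact Int.natCast_dvd_natCast.2 hpm
    have hveq : (primesEquiv (R := ℤ)).symm ⟨p, hp⟩ = v :=
      (primesEquiv (R := ℤ)).symm_apply_eq.mpr (Subtype.ext hv.symm)
    constructor
    · -- `p ∣ Δ(W₀) = 16 (ab(a+b))²`, so `f_p ≠ 0`
      have hΔ : (natGenerator v : ℤ) ∣ W₀.Δ := by
        rw [hv, hW₀, freyIntModel_Δ]; exact dvd_mul_of_dvd_right (dvd_pow hpm' two_ne_zero) _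
      have hf := conductorExponent_ne_zero_of_dvd_Δ hmin hΔ
      have hfac : N.factorization p ≠ 0 := by
        rw [hNdef, show p = ((⟨p, hp⟩ : Nat.Primes) : ℕ) from rfl,
          factorization_conductorNorm_primesEquiv_symm, hveq]
        exact hf
      have : p ∈ N.factorization.support := Finsupp.mem_support_iff.2 hfac
      rwa [Nat.support_factorization] at this
    · -- `p^{v_p(abc)} ∣ Δ(W₀)` and `W₀` is minimal at `p`, so `v_p(abc) ≤ ord_p(Δ_min) = v_p(D)`
      set k := (a * b * c).factorization p with hk
      have hpk : (natGenerator v : ℤ) ^ k ∣ W₀.Δ := by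
        rw [hv, hW₀, freyIntModel_Δ]
        have h1 : (p : ℤ) ^ k ∣ (a : ℤ) * b * (a + b) := by
          rw [hP]; exact_mod_cast Nat.ordProj_dvd (a * b * c) p
        exact dvd_mul_of_dvd_right (dvd_pow h1 two_ne_zero) _
      have hval := valuation_Δ_eq_of_isMinimalAt_holds v (W₀.baseChange ℚ) hmin
      rw [baseChange_int_Δ] at hval
      have hle := (Literature.NumberTheory.EllipticCurves.Rat.valuation_intCast_le_exp_iff v _ k).2 hpk
      rw [hval, WithZero.exp_le_exp, neg_le_neg_iff, Nat.cast_le] at hle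
      have hfacD := factorization_minimalDiscriminantNorm_holds (W₀.baseChange ℚ) v
      rw [hv] at hfacD
      rw [hDdef, hfacD]
      exact hle
  -- the odd primes of `abc` are odd multiplicative primes
  have hsub : (a * b * c).primeFactors.erase 2 ⊆
      N.primeFactors.filter (fun p => p ≠ 2 ∧ ¬ p ^ 2 ∣ N) := by
    intro p hp
    rw [Finset.mem_erase] at hp
    have hp' : p.Prime := Nat.prime_of_mem_primeFactors hp.2
    rw [Finset.mem_filter]
    exact ⟨(hodd p hp' hp.1 (Nat.dvd_of_mem_primeFactors hp.2)).1, hp.1, hss p hp' hp.1⟩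
  refine ⟨hsub, ?_⟩
  -- assemble
  rw [exponentProduct_def, multiplicativeValuationProduct_def]
  refine AbcValuationProduct.prod_le_four_mul_prod ?_ ?_ ?_ (Or.inl ?_)
  · intro p hp; have := hsub hp; rw [Finset.mem_filter] at this ⊢; exact ⟨this.1, this.2.2⟩
  · intro p hp; rw [Finset.mem_filter] at hp
    have hp' : p.Prime := Nat.prime_of_mem_primeFactors hp.1
    exact (hp'.dvd_iff_one_le_factorization hD0).1 ((Nat.dvd_of_mem_primeFactors hp.1).trans hND)
  · intro p hp; rw [Finset.mem_erase] at hp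
    exact (hodd p (Nat.prime_of_mem_primeFactors hp.2) hp.1 (Nat.dvd_of_mem_primeFactors hp.2)).2
  · -- `v₂(abc) ≤ 4` as `32 ∤ abc`
    by_contra h5
    exact h32 ((Nat.prime_two.pow_dvd_iff_le_factorization (k := 5) habc0).2 (by omega))

/-! ### The glue: r2 → r4 → `AbcValuationProduct` -/

/-- **Frey translation, packaged.** Every abc triple carries an elliptic curve `E/ℚ`, semistable
away from `2`, with `N_E ∣ 2⁸ rad(abc)`, whose odd multiplicative primes contain the odd primes of
`abc`, and with `∏_{p ∣ abc} v_p(abc) ≤ 4 T(E)` (so r2 applies as soon as `ω(abc) ≥ 5`, which is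
what the glue `SubexpManyPrimesOfValuationProduct` needs). `[folklore]` -/
theorem AbcValuationProduct.exists_freyCurve {a b c : ℕ} (h : IsABCTriple a b c) :
    ∃ W : WeierstrassCurve ℚ, W.IsElliptic ∧
      (∀ p : ℕ, p.Prime → p ≠ 2 → ¬ p ^ 2 ∣ W.conductorNorm ℤ) ∧
      W.conductorNorm ℤ ∣ 2 ^ 8 * rad a b c ∧
      (a * b * c).primeFactors.erase 2 ⊆
        (W.conductorNorm ℤ).primeFactors.filter (fun p => p ≠ 2 ∧ ¬ p ^ 2 ∣ W.conductorNorm ℤ) ∧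
      exponentProduct (a * b * c) ≤ 4 * multiplicativeValuationProduct W := by
  by_cases h32 : 32 ∣ a * b * c
  · exact AbcValuationProduct.exists_freyCurve_of_dvd h h32
  · exact AbcValuationProduct.exists_freyCurve_of_not_dvd h h32

/-- **Glue B of route ABC/RibetTakahashiSplit** (`ValuationProductOfCurves`, proved): the
many-prime crux `ManyPrimeValuationProduct` and the few-prime crux `FewPrimeValuationProduct`
together imply `AbcValuationProduct`. For a triple take the Frey curve of
`AbcValuationProduct.exists_freyCurve`; r2 (if it has `≥ 4` odd multiplicative primes) or r4
(if `≤ 3`) bounds `T(E) ≤ C N^ε`, and `∏ v_p(abc) ≤ 4 T(E) ≤ 4 C (2⁸ rad)^ε`. `[folklore]` -/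
theorem exponentProductBound_of_many_few (h₂ : ManyPrimeValuationProduct)
    (h₄ : FewPrimeValuationProduct) : ∀ ε : ℝ, 0 < ε → ∃ K : ℝ, ∀ a b c : ℕ,
      IsABCTriple a b c → (exponentProduct (a * b * c) : ℝ) ≤ K * (rad a b c : ℝ) ^ ε := by
  intro ε hε
  obtain ⟨C₂, hC₂⟩ := h₂ ε hε
  obtain ⟨C₄, hC₄⟩ := h₄ ε hε
  set C₀ : ℝ := max (max C₂ C₄) 0 with hC₀def
  have hC₀0 : 0 ≤ C₀ := le_max_right _ _
  refine ⟨4 * C₀ * ((2 : ℝ) ^ 8) ^ ε, fun a b c ht => ?_⟩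
  obtain ⟨W, hE, hss, hN, -, hprod⟩ := AbcValuationProduct.exists_freyCurve ht
  have hR : (0 : ℝ) < (rad a b c : ℝ) := cast_rad_pos a b c
  -- `T(E) ≤ C₀ N^ε` from r2 or r4
  have hT : (multiplicativeValuationProduct W : ℝ) ≤ C₀ * (W.conductorNorm ℤ : ℝ) ^ ε := by
    rcases le_or_gt 4 (((W.conductorNorm ℤ).primeFactors.filter
        (fun p => p ≠ 2 ∧ ¬ p ^ 2 ∣ W.conductorNorm ℤ)).card) with h4 | h3
    · calc (multiplicativeValuationProduct W : ℝ) ≤ C₂ * (W.conductorNorm ℤ : ℝ) ^ ε := hC₂ W hss h4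
        _ ≤ C₀ * (W.conductorNorm ℤ : ℝ) ^ ε := mul_le_mul_of_nonneg_right
            ((le_max_left _ _).trans (le_max_left _ _)) (by positivity)
    · calc (multiplicativeValuationProduct W : ℝ) ≤ C₄ * (W.conductorNorm ℤ : ℝ) ^ ε :=
            hC₄ W hss (Nat.lt_succ_iff.1 h3)
        _ ≤ C₀ * (W.conductorNorm ℤ : ℝ) ^ ε := mul_le_mul_of_nonneg_right
            ((le_max_right _ _).trans (le_max_left _ _)) (by positivity)
  -- `N ≤ 2⁸ rad`
  have hNR : (W.conductorNorm ℤ : ℝ) ≤ 2 ^ 8 * (rad a b c : ℝ) := by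
    have := Nat.le_of_dvd (mul_pos (by positivity) (by rw [rad_def]; exact Nat.radical_pos _)) hN
    exact_mod_cast this
  calc (exponentProduct (a * b * c) : ℝ) ≤ ((4 * multiplicativeValuationProduct W : ℕ) : ℝ) := by
        exact_mod_cast hprod
    _ = 4 * (multiplicativeValuationProduct W : ℝ) := by push_cast; ring
    _ ≤ 4 * (C₀ * (W.conductorNorm ℤ : ℝ) ^ ε) := by linarith
    _ ≤ 4 * (C₀ * ((2 : ℝ) ^ 8 * (rad a b c : ℝ)) ^ ε) := by gcongr
    _ = 4 * C₀ * ((2 : ℝ) ^ 8) ^ ε * (rad a b c : ℝ) ^ ε := by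
        rw [Real.mul_rpow (by positivity) hR.le]; ring

/-- The route's glue item `ValuationProductOfCurves` (r2 → r4 → `AbcValuationProduct`) holds.
`[folklore]` -/
theorem valuationProductOfCurves : ValuationProductOfCurves :=
  fun h₂ h₄ => exponentProductBound_of_many_few h₂ h₄

/-! ### What the milestone takes from each regime

Only the r2 half of `exponentProductBound_of_many_few` needs a statement about curves: in the
few-prime case the triple itself has `≤ 3` odd prime factors, so modulo r2 the milestone is
EQUIVALENT to its own restriction to such triples (weaker than `FewPrimeValuationProduct`). -/

/-- **Many-prime half of the milestone, from r2 alone.** `ManyPrimeValuationProduct` implies the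
product-of-valuations bound with exponent `ε` for every abc triple whose product has at least `4`
odd prime factors: the Frey curve of `AbcValuationProduct.exists_freyCurve` then has `≥ 4` odd
multiplicative primes, r2 gives `T(E) ≤ C N^ε`, and `∏ v_p(abc) ≤ 4 T(E) ≤ 4 C (2⁸ rad)^ε`; the
few-prime crux is not used. `[folklore]` -/
theorem AbcValuationProduct.manyPrimes_of_manyPrimeValuationProduct
    (h₂ : ManyPrimeValuationProduct) :
    ∀ ε : ℝ, 0 < ε → ∃ K : ℝ, ∀ a b c : ℕ, IsABCTriple a b c →
      4 ≤ ((a * b * c).primeFactors.erase 2).card →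
      (exponentProduct (a * b * c) : ℝ) ≤ K * (rad a b c : ℝ) ^ ε := by
  intro ε hε
  obtain ⟨C₂, hC₂⟩ := h₂ ε hε
  refine ⟨4 * max C₂ 0 * ((2 : ℝ) ^ 8) ^ ε, fun a b c ht h4 => ?_⟩
  obtain ⟨W, hE, hss, hN, hsub, hprod⟩ := AbcValuationProduct.exists_freyCurve ht
  have hR : (0 : ℝ) < (rad a b c : ℝ) := cast_rad_pos a b c
  -- the Frey curve has `≥ 4` odd multiplicative primes, so r2 applies
  have h4' : 4 ≤ ((W.conductorNorm ℤ).primeFactors.filter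
      (fun p => p ≠ 2 ∧ ¬ p ^ 2 ∣ W.conductorNorm ℤ)).card :=
    h4.trans (Finset.card_le_card hsub)
  have hT : (multiplicativeValuationProduct W : ℝ) ≤ max C₂ 0 * (W.conductorNorm ℤ : ℝ) ^ ε :=
    (hC₂ W hss h4').trans (mul_le_mul_of_nonneg_right (le_max_left _ _) (by positivity))
  -- `N ≤ 2⁸ rad`
  have hNR : (W.conductorNorm ℤ : ℝ) ≤ 2 ^ 8 * (rad a b c : ℝ) := by
    have := Nat.le_of_dvd (mul_pos (by positivity) (by rw [rad_def]; exact Nat.radical_pos _)) hN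
    exact_mod_cast this
  have hC0 : (0 : ℝ) ≤ max C₂ 0 := le_max_right _ _
  calc (exponentProduct (a * b * c) : ℝ) ≤ ((4 * multiplicativeValuationProduct W : ℕ) : ℝ) := by
        exact_mod_cast hprod
    _ = 4 * (multiplicativeValuationProduct W : ℝ) := by push_cast; ring
    _ ≤ 4 * (max C₂ 0 * (W.conductorNorm ℤ : ℝ) ^ ε) := by linarith
    _ ≤ 4 * (max C₂ 0 * ((2 : ℝ) ^ 8 * (rad a b c : ℝ)) ^ ε) := by gcongr
    _ = 4 * max C₂ 0 * ((2 : ℝ) ^ 8) ^ ε * (rad a b c : ℝ) ^ ε := by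
        rw [Real.mul_rpow (by positivity) hR.le]; ring

/-- **The few-prime input the milestone actually consumes.** `ManyPrimeValuationProduct` together
with the restriction of the milestone to abc triples whose product has at most `3` odd prime
factors (the Pillai-type regime `p^x ± q^y = 2^k r^z`) already gives `AbcValuationProduct`: split
a triple by the number of odd prime factors of `abc`. `[folklore]` -/
theorem exponentProductBound_of_manyPrimeValuationProduct_of_fewPrimes
    (h₂ : ManyPrimeValuationProduct)
    (h₄ : ∀ ε : ℝ, 0 < ε → ∃ K : ℝ, ∀ a b c : ℕ, IsABCTriple a b c →
      ((a * b * c).primeFactors.erase 2).card ≤ 3 →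
      (exponentProduct (a * b * c) : ℝ) ≤ K * (rad a b c : ℝ) ^ ε) :
    ∀ ε : ℝ, 0 < ε → ∃ K : ℝ, ∀ a b c : ℕ, IsABCTriple a b c →
      (exponentProduct (a * b * c) : ℝ) ≤ K * (rad a b c : ℝ) ^ ε := by
  intro ε hε
  obtain ⟨K₂, hK₂⟩ := AbcValuationProduct.manyPrimes_of_manyPrimeValuationProduct h₂ ε hε
  obtain ⟨K₄, hK₄⟩ := h₄ ε hε
  refine ⟨max K₂ K₄, fun a b c ht => ?_⟩
  have hR : (0 : ℝ) < (rad a b c : ℝ) := cast_rad_pos a b c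
  rcases le_or_gt 4 ((a * b * c).primeFactors.erase 2).card with h4 | h3
  · exact (hK₂ a b c ht h4).trans (mul_le_mul_of_nonneg_right (le_max_left _ _) (by positivity))
  · exact (hK₄ a b c ht (Nat.lt_succ_iff.1 h3)).trans
      (mul_le_mul_of_nonneg_right (le_max_right _ _) (by positivity))

/-- **Modulo r2, the milestone is its few-prime shadow.** Given `ManyPrimeValuationProduct`,
`AbcValuationProduct` is equivalent to its restriction to abc triples with at most `3` odd prime
factors of `abc` (one direction is restriction, the other is
`exponentProductBound_of_manyPrimeValuationProduct_of_fewPrimes`). This restriction (uniformly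
`x·y·z·k ≪_ε (pqr)^ε` over `p^x ± q^y = 2^k r^z`-type equations) is the exact residual content of
the milestone once r2 is available; weaker than `FewPrimeValuationProduct`, still open. `[folklore]` -/
theorem exponentProductBound_iff_fewPrimes_of_manyPrimeValuationProduct
    (h₂ : ManyPrimeValuationProduct) :
    (∀ ε : ℝ, 0 < ε → ∃ K : ℝ, ∀ a b c : ℕ, IsABCTriple a b c →
      (exponentProduct (a * b * c) : ℝ) ≤ K * (rad a b c : ℝ) ^ ε) ↔
    ∀ ε : ℝ, 0 < ε → ∃ K : ℝ, ∀ a b c : ℕ, IsABCTriple a b c →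
      ((a * b * c).primeFactors.erase 2).card ≤ 3 →
      (exponentProduct (a * b * c) : ℝ) ≤ K * (rad a b c : ℝ) ^ ε := by
  refine ⟨fun h ε hε => ?_, exponentProductBound_of_manyPrimeValuationProduct_of_fewPrimes h₂⟩
  exact (h ε hε).imp fun K hK a b c ht _ => hK a b c ht

/-- Deprecated old spellings of the three `exponentProductBound_…` theorems above (whose types
named the dropped route decl `AbcValuationProduct`; same statements, spelled out). `[folklore]` -/
@[deprecated exponentProductBound_of_many_few (since := "2026-08-16")]
alias abcValuationProduct_of_many_few := exponentProductBound_of_many_few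
@[deprecated exponentProductBound_of_manyPrimeValuationProduct_of_fewPrimes (since := "2026-08-16")]
alias abcValuationProduct_of_manyPrimeValuationProduct_of_fewPrimes :=
  exponentProductBound_of_manyPrimeValuationProduct_of_fewPrimes
@[deprecated exponentProductBound_iff_fewPrimes_of_manyPrimeValuationProduct
  (since := "2026-08-16")]
alias abcValuationProduct_iff_fewPrimes_of_manyPrimeValuationProduct :=
  exponentProductBound_iff_fewPrimes_of_manyPrimeValuationProduct

end Summit.ABC.ABC.Theorems
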